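import Mathlib
import Summits.NavierStokesRegularity.NavierStokesRegularity.Theorems.EulerZoomLiouvillePowerGaugeEulerLiouvilleNeedleStrainClockPast
import HarnessLib.Audit

/-!
# Crux E `EulerZoomLiouville.PowerGaugeEulerLiouville` — COMPRESSION IS THE STRONGER CLOCK HYPOTHESIS (t40d remark, typed):
# `tr DV = 0` turns a compression bound `−k‖v‖² ≤ ⟪DV v, v⟫` into the stretching bound `⟪DV v, v⟫ ≤ 2k‖v‖²`

Route №10 `EulerZoomLiouville` (NavierStokesRegularity), crux E = stmt-NavierStokesRegularity-19832, registered residue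
`stub_selfSimilarC2Needle`, binder `¬ HasResidenceClock ρ V` (LEAD ns-typeII-p2 g12, skeleton v72: alternatives 3/4 = this seat's
stretching clocks p648071/p648172); seat ns-ezl-w5 g3, `--supports stmt-NavierStokesRegularity-19832 --as helper`.  The REMARK of
…NeedleStrainClock («(S4) ⊂ (S3) with `s = 2k`», certified by nsreg-p2 g33 for ROUND-40 §1 (S)) as theorems:

* `NeedleClock.inner_le_two_mul_of_trace_eq_zero` — linear algebra on `ℝ³`: `tr A = 0` and `−k‖v‖² ≤ ⟪A v, v⟫` for all `v`
  ⇒ `⟪A v, v⟫ ≤ 2k‖v‖²` for all `v` (orthonormal frame through `v̂`, `LinearMap.trace_eq_sum_inner`; the pattern of t40e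
  `Stagnation.exists_inner_fderiv_le_neg_half_of_stagnation`);
* `NeedleClock.stretching_le_two_mul_of_compression` — for a divergence-free `C¹` field the pointwise version;
* **`NeedleRace.selfSimilar_ae_eq_zero_of_compressionClockC2`** (`k < 1/2` + sub-power vorticity envelope) and
  **`NeedleRace.selfSimilar_ae_eq_zero_of_strongCompressionClockC2`** (`k < (1+2ρ)/(4(2+ρ))`, no envelope) — the origin
  members, = `…strainClockC2` / `…strongStrainClockC2` at `s = 2k`; past twins `…_past` likewise.

The converse fails (eigenvalues `(s, s, −2s)`), so the compression strata are CONTAINED in the stretching strata: no new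
alternative of `HasResidenceClock` is needed — these are convenience entries.  NOT NS, not E: conditional strata of the crux
CLASS (MODEL lattice); 19832 OPEN.  [cite: ConstantinIgnatovaVicol2026Putative, §3.4–§3.5; folklore]
-/

noncomputable section

-- the summit and its single problem share the name `NavierStokesRegularity` (D-0017 nested layout)
set_option linter.dupNamespace false

open Set Filter Topology Metric Function MeasureTheory InnerProductSpace
open scoped RealInnerProductSpace NNReal ENNReal

namespace Summit.NavierStokesRegularity.NavierStokesRegularity.Theorems.PowerGaugeEulerLiouville

open Literature.Analysis Literature.Analysis.FluidPDE

namespace NeedleClock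

/-- **Trace zero turns a compression bound into a stretching bound.**  For a linear map `A` of `ℝ³` with `tr A = 0`:
if `−k‖v‖² ≤ ⟪A v, v⟫` for all `v`, then `⟪A v, v⟫ ≤ 2k‖v‖²` for all `v` (in an orthonormal frame `(v̂, b₁, b₂)`,
`⟪A v̂, v̂⟫ = −⟪A b₁, b₁⟫ − ⟪A b₂, b₂⟫ ≤ 2k`). [folklore] -/
theorem inner_le_two_mul_of_trace_eq_zero (A : EuclideanSpace ℝ (Fin 3) →L[ℝ] EuclideanSpace ℝ (Fin 3))
    (htr : LinearMap.trace ℝ (EuclideanSpace ℝ (Fin 3))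
      (A : EuclideanSpace ℝ (Fin 3) →ₗ[ℝ] EuclideanSpace ℝ (Fin 3)) = 0)
    {k : ℝ} (hk : ∀ v : EuclideanSpace ℝ (Fin 3), -(k * ‖v‖ ^ 2) ≤ ⟪A v, v⟫) (v : EuclideanSpace ℝ (Fin 3)) :
    ⟪A v, v⟫ ≤ 2 * k * ‖v‖ ^ 2 := by
  by_cases hv : v = 0
  · rw [hv, map_zero, inner_zero_left, norm_zero]; simp
  have hn : ‖v‖ ≠ 0 := norm_ne_zero_iff.2 hv
  have hnpos : 0 < ‖v‖ := norm_pos_iff.2 hv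
  set e : EuclideanSpace ℝ (Fin 3) := ‖v‖⁻¹ • v with he
  have he1 : ‖e‖ = 1 := by rw [he, norm_smul, norm_inv, norm_norm, inv_mul_cancel₀ hn]
  -- an orthonormal basis through `e`
  set w : Fin 3 → EuclideanSpace ℝ (Fin 3) := fun _ => e with hw
  have hon : Orthonormal ℝ (({0} : Set (Fin 3)).restrict w) := by
    refine ⟨fun i => by simp [hw, he1], fun i j hij => ?_⟩
    exact absurd (Subsingleton.elim i j) hij
  obtain ⟨b, hb⟩ := Orthonormal.exists_orthonormalBasis_extension_of_card_eq (𝕜 := ℝ)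
    (E := EuclideanSpace ℝ (Fin 3)) (by rw [finrank_euclideanSpace_fin, Fintype.card_fin]) hon
  have hb0 : b 0 = e := hb 0 rfl
  -- the trace identity in the frame `b`
  have htr' := htr
  rw [(A : EuclideanSpace ℝ (Fin 3) →ₗ[ℝ] EuclideanSpace ℝ (Fin 3)).trace_eq_sum_inner b, Fin.sum_univ_three, hb0] at htr'
  simp only [ContinuousLinearMap.coe_coe] at htr'
  have h1 := hk (b 1)
  have h2 := hk (b 2)
  rw [b.orthonormal.1 1, real_inner_comm] at h1
  rw [b.orthonormal.1 2, real_inner_comm] at h2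
  -- `⟪A e, e⟫ ≤ 2k`
  have hee : ⟪A e, e⟫ ≤ 2 * k := by
    rw [real_inner_comm]
    nlinarith [htr', h1, h2]
  -- rescale
  have hve : v = ‖v‖ • e := by
    rw [he, smul_smul, mul_inv_cancel₀ hn, one_smul]
  calc ⟪A v, v⟫ = ‖v‖ ^ 2 * ⟪A e, e⟫ := by
        conv_lhs => rw [hve]
        rw [map_smul, real_inner_smul_left, real_inner_smul_right]; ring
    _ ≤ ‖v‖ ^ 2 * (2 * k) := mul_le_mul_of_nonneg_left hee (sq_nonneg _)
    _ = 2 * k * ‖v‖ ^ 2 := by ring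

variable {ρ : ℝ} {V : EuclideanSpace ℝ (Fin 3) → EuclideanSpace ℝ (Fin 3)} {P' : EuclideanSpace ℝ (Fin 3) → ℝ}

/-- **For a divergence-free profile, a compression bound `k` is a stretching bound `2k`**: if `(V, P′)` is a classical
self-similar Euler profile (so `div V = 0`) and `−k‖v‖² ≤ ⟪DV(z) v, v⟫` for all `z, v`, then `⟪DV(z) v, v⟫ ≤ 2k‖v‖²` for
all `z, v`. [folklore] -/
theorem stretching_le_two_mul_of_compression {γ : ℝ} (hprof : IsSelfSimilarEulerProfile γ 0 V P') {k : ℝ}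
    (hk : ∀ z v : EuclideanSpace ℝ (Fin 3), -(k * ‖v‖ ^ 2) ≤ ⟪fderiv ℝ V z v, v⟫) :
    ∀ z v : EuclideanSpace ℝ (Fin 3), ⟪fderiv ℝ V z v, v⟫ ≤ (2 * k) * ‖v‖ ^ 2 :=
  fun z v => inner_le_two_mul_of_trace_eq_zero (fderiv ℝ V z) (hprof.divFree z) (hk z) v

end NeedleClock

/-! ## Member level: compression forms of the strain clocks (`s = 2k`) -/

namespace NeedleRace

variable {ρ T T₁ : ℝ} {V : EuclideanSpace ℝ (Fin 3) → EuclideanSpace ℝ (Fin 3)}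
  {u : ℝ → EuclideanSpace ℝ (Fin 3) → EuclideanSpace ℝ (Fin 3)} {p : ℝ → EuclideanSpace ℝ (Fin 3) → ℝ}
  {H : ℝ → EuclideanSpace ℝ (Fin 3) → EuclideanSpace ℝ (Fin 3) →L[ℝ] EuclideanSpace ℝ (Fin 3)} {c : ℝ≥0}
  {P : EuclideanSpace ℝ (Fin 3) → ℝ}

/-- **SUBCRITICAL COMPRESSION CLOCK AT MEMBER LEVEL** (`k < 1/2` + sub-power vorticity envelope): the `s = 2k` instance of
`selfSimilar_ae_eq_zero_of_strainClockC2`. [cite: ConstantinIgnatovaVicol2026Putative, §3.5] -/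
theorem selfSimilar_ae_eq_zero_of_compressionClockC2 (hρ : 0 < ρ) (hρ1 : ρ ≤ 1 / 2)
    (hsw : IsSuitableWeakSolutionOn (slab (EuclideanSpace ℝ (Fin 3)) (Iio 0) isOpen_Iio) 0 0 u p)
    (hH : HasWeakSpatialGradientOn (slab (EuclideanSpace ℝ (Fin 3)) (Iio 0) isOpen_Iio) u H)
    (hgauge : ∀ a : ℝ, 0 < a →
      ENNReal.ofReal (a ^ (2 * ρ)) * cknA a (0 : ℝ × EuclideanSpace ℝ (Fin 3)) u +
          ENNReal.ofReal (a ^ ρ) * cknE a (0 : ℝ × EuclideanSpace ℝ (Fin 3)) H +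
        ENNReal.ofReal (a ^ (2 * ρ)) * cknD a (0 : ℝ × EuclideanSpace ℝ (Fin 3)) p ≤ (c : ℝ≥0∞))
    (hu : ∀ τ : ℝ, τ < 0 → u τ = selfSimilarCollapse (1 / (2 + ρ)) 0 V τ)
    (hp : ∀ τ : ℝ, τ < 0 → p τ = selfSimilarCollapsePressure (1 / (2 + ρ)) 0 P τ)
    (hV : ContDiff ℝ 2 V) {k : ℝ} (hk2 : k < 1 / 2)
    (hcomp : ∀ z v : EuclideanSpace ℝ (Fin 3), -(k * ‖v‖ ^ 2) ≤ ⟪fderiv ℝ V z v, v⟫)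
    (henv : ∀ ε : ℝ, 0 < ε → ∃ R₂ : ℝ, ∀ z : EuclideanSpace ℝ (Fin 3), R₂ ≤ ‖z‖ →
      Real.log ‖curl V z‖ ≤ ε * ‖z‖ ^ (2 + ρ)) :
    uncurry u =ᵐ[volume.restrict (Iio (0 : ℝ) ×ˢ (univ : Set (EuclideanSpace ℝ (Fin 3))))] 0 := by
  have hu' : ∀ τ : ℝ, τ < 0 → u τ = fun x => selfSimilarCollapse (1 / (2 + ρ)) 0 V τ (x - 0) := by
    intro τ hτ; rw [hu τ hτ]; funext x; rw [sub_zero]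
  have hp' : ∀ τ : ℝ, τ < 0 → p τ = fun x => selfSimilarCollapsePressure (1 / (2 + ρ)) 0 P τ (x - 0) := by
    intro τ hτ; rw [hp τ hτ]; funext x; rw [sub_zero]
  obtain ⟨P', hprof⟩ := Past.exists_isSelfSimilarEulerProfile hρ le_rfl le_rfl hsw.distributional hu' hp' hV
  exact selfSimilar_ae_eq_zero_of_strainClockC2 hρ hρ1 hsw hH hgauge hu hp hV (by linarith : 2 * k < 1)
    (NeedleClock.stretching_le_two_mul_of_compression hprof hcomp) henv

/-- **ENVELOPE-FREE COMPRESSION CLOCK AT MEMBER LEVEL** (`k < (1+2ρ)/(4(2+ρ))`): the `s = 2k` instance of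
`selfSimilar_ae_eq_zero_of_strongStrainClockC2`. [cite: ConstantinIgnatovaVicol2026Putative, §3.5] -/
theorem selfSimilar_ae_eq_zero_of_strongCompressionClockC2 (hρ : 0 < ρ) (hρ1 : ρ ≤ 1 / 2)
    (hsw : IsSuitableWeakSolutionOn (slab (EuclideanSpace ℝ (Fin 3)) (Iio 0) isOpen_Iio) 0 0 u p)
    (hH : HasWeakSpatialGradientOn (slab (EuclideanSpace ℝ (Fin 3)) (Iio 0) isOpen_Iio) u H)
    (hgauge : ∀ a : ℝ, 0 < a →
      ENNReal.ofReal (a ^ (2 * ρ)) * cknA a (0 : ℝ × EuclideanSpace ℝ (Fin 3)) u +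
          ENNReal.ofReal (a ^ ρ) * cknE a (0 : ℝ × EuclideanSpace ℝ (Fin 3)) H +
        ENNReal.ofReal (a ^ (2 * ρ)) * cknD a (0 : ℝ × EuclideanSpace ℝ (Fin 3)) p ≤ (c : ℝ≥0∞))
    (hu : ∀ τ : ℝ, τ < 0 → u τ = selfSimilarCollapse (1 / (2 + ρ)) 0 V τ)
    (hp : ∀ τ : ℝ, τ < 0 → p τ = selfSimilarCollapsePressure (1 / (2 + ρ)) 0 P τ)
    (hV : ContDiff ℝ 2 V) {k : ℝ} (hk : k < (1 + 2 * ρ) / (4 * (2 + ρ)))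
    (hcomp : ∀ z v : EuclideanSpace ℝ (Fin 3), -(k * ‖v‖ ^ 2) ≤ ⟪fderiv ℝ V z v, v⟫) :
    uncurry u =ᵐ[volume.restrict (Iio (0 : ℝ) ×ˢ (univ : Set (EuclideanSpace ℝ (Fin 3))))] 0 := by
  have h2ρ : (0 : ℝ) < 2 + ρ := by linarith
  have hu' : ∀ τ : ℝ, τ < 0 → u τ = fun x => selfSimilarCollapse (1 / (2 + ρ)) 0 V τ (x - 0) := by
    intro τ hτ; rw [hu τ hτ]; funext x; rw [sub_zero]
  have hp' : ∀ τ : ℝ, τ < 0 → p τ = fun x => selfSimilarCollapsePressure (1 / (2 + ρ)) 0 P τ (x - 0) := by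
    intro τ hτ; rw [hp τ hτ]; funext x; rw [sub_zero]
  obtain ⟨P', hprof⟩ := Past.exists_isSelfSimilarEulerProfile hρ le_rfl le_rfl hsw.distributional hu' hp' hV
  have hs : 2 * k < (1 + 2 * ρ) / (2 * (2 + ρ)) := by
    have h1 : k * (4 * (2 + ρ)) < 1 + 2 * ρ := (lt_div_iff₀ (by positivity)).1 hk
    rw [lt_div_iff₀ (by positivity)]
    nlinarith
  exact selfSimilar_ae_eq_zero_of_strongStrainClockC2 hρ hρ1 hsw hH hgauge hu hp hV hs
    (NeedleClock.stretching_le_two_mul_of_compression hprof hcomp)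

/-- **SUBCRITICAL COMPRESSION CLOCK, PAST-EXACT MEMBER** (`k < 1/2` + envelope): the `s = 2k` instance of
`selfSimilar_ae_eq_zero_of_strainClockC2_past`. [cite: ConstantinIgnatovaVicol2026Putative, §3.5] -/
theorem selfSimilar_ae_eq_zero_of_compressionClockC2_past (hρ : 0 < ρ) (hρh : ρ ≤ 1 / 2) (hT₁ : T₁ ≤ 0)
    (hTT₁ : T₁ ≤ T) (x₀ : EuclideanSpace ℝ (Fin 3))
    (hsw : IsSuitableWeakSolutionOn (slab (EuclideanSpace ℝ (Fin 3)) (Iio 0) isOpen_Iio) 0 0 u p)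
    (hH : HasWeakSpatialGradientOn (slab (EuclideanSpace ℝ (Fin 3)) (Iio 0) isOpen_Iio) u H)
    (hgauge : ∀ a : ℝ, 0 < a →
      ENNReal.ofReal (a ^ (2 * ρ)) * cknA a (0 : ℝ × EuclideanSpace ℝ (Fin 3)) u +
          ENNReal.ofReal (a ^ ρ) * cknE a (0 : ℝ × EuclideanSpace ℝ (Fin 3)) H +
        ENNReal.ofReal (a ^ (2 * ρ)) * cknD a (0 : ℝ × EuclideanSpace ℝ (Fin 3)) p ≤ (c : ℝ≥0∞))
    (hu : ∀ τ : ℝ, τ < T₁ → u τ = fun x => selfSimilarCollapse (1 / (2 + ρ)) T V τ (x - x₀))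
    (hp : ∀ τ : ℝ, τ < T₁ → p τ = fun x => selfSimilarCollapsePressure (1 / (2 + ρ)) T P τ (x - x₀))
    (hV : ContDiff ℝ 2 V) {k : ℝ} (hk2 : k < 1 / 2)
    (hcomp : ∀ z v : EuclideanSpace ℝ (Fin 3), -(k * ‖v‖ ^ 2) ≤ ⟪fderiv ℝ V z v, v⟫)
    (henv : ∀ ε : ℝ, 0 < ε → ∃ R₂ : ℝ, ∀ z : EuclideanSpace ℝ (Fin 3), R₂ ≤ ‖z‖ →
      Real.log ‖curl V z‖ ≤ ε * ‖z‖ ^ (2 + ρ)) :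
    uncurry u =ᵐ[volume.restrict (Iio (0 : ℝ) ×ˢ (univ : Set (EuclideanSpace ℝ (Fin 3))))] 0 := by
  obtain ⟨P', hprof⟩ := Past.exists_isSelfSimilarEulerProfile hρ hT₁ hTT₁ hsw.distributional hu hp hV
  exact selfSimilar_ae_eq_zero_of_strainClockC2_past hρ hρh hT₁ hTT₁ x₀ hsw hH hgauge hu hp hV
    (by linarith : 2 * k < 1) (NeedleClock.stretching_le_two_mul_of_compression hprof hcomp) henv

/-- **ENVELOPE-FREE COMPRESSION CLOCK, PAST-EXACT MEMBER** (`k < (1+2ρ)/(4(2+ρ))`): the `s = 2k` instance of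
`selfSimilar_ae_eq_zero_of_strongStrainClockC2_past`. [cite: ConstantinIgnatovaVicol2026Putative, §3.5] -/
theorem selfSimilar_ae_eq_zero_of_strongCompressionClockC2_past (hρ : 0 < ρ) (hρh : ρ ≤ 1 / 2) (hT₁ : T₁ ≤ 0)
    (hTT₁ : T₁ ≤ T) (x₀ : EuclideanSpace ℝ (Fin 3))
    (hsw : IsSuitableWeakSolutionOn (slab (EuclideanSpace ℝ (Fin 3)) (Iio 0) isOpen_Iio) 0 0 u p)
    (hH : HasWeakSpatialGradientOn (slab (EuclideanSpace ℝ (Fin 3)) (Iio 0) isOpen_Iio) u H)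
    (hgauge : ∀ a : ℝ, 0 < a →
      ENNReal.ofReal (a ^ (2 * ρ)) * cknA a (0 : ℝ × EuclideanSpace ℝ (Fin 3)) u +
          ENNReal.ofReal (a ^ ρ) * cknE a (0 : ℝ × EuclideanSpace ℝ (Fin 3)) H +
        ENNReal.ofReal (a ^ (2 * ρ)) * cknD a (0 : ℝ × EuclideanSpace ℝ (Fin 3)) p ≤ (c : ℝ≥0∞))
    (hu : ∀ τ : ℝ, τ < T₁ → u τ = fun x => selfSimilarCollapse (1 / (2 + ρ)) T V τ (x - x₀))
    (hp : ∀ τ : ℝ, τ < T₁ → p τ = fun x => selfSimilarCollapsePressure (1 / (2 + ρ)) T P τ (x - x₀))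
    (hV : ContDiff ℝ 2 V) {k : ℝ} (hk : k < (1 + 2 * ρ) / (4 * (2 + ρ)))
    (hcomp : ∀ z v : EuclideanSpace ℝ (Fin 3), -(k * ‖v‖ ^ 2) ≤ ⟪fderiv ℝ V z v, v⟫) :
    uncurry u =ᵐ[volume.restrict (Iio (0 : ℝ) ×ˢ (univ : Set (EuclideanSpace ℝ (Fin 3))))] 0 := by
  have h2ρ : (0 : ℝ) < 2 + ρ := by linarith
  obtain ⟨P', hprof⟩ := Past.exists_isSelfSimilarEulerProfile hρ hT₁ hTT₁ hsw.distributional hu hp hV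
  have hs : 2 * k < (1 + 2 * ρ) / (2 * (2 + ρ)) := by
    have h1 : k * (4 * (2 + ρ)) < 1 + 2 * ρ := (lt_div_iff₀ (by positivity)).1 hk
    rw [lt_div_iff₀ (by positivity)]
    nlinarith
  exact selfSimilar_ae_eq_zero_of_strongStrainClockC2_past hρ hρh hT₁ hTT₁ x₀ hsw hH hgauge hu hp hV hs
    (NeedleClock.stretching_le_two_mul_of_compression hprof hcomp)

end NeedleRace

end Summit.NavierStokesRegularity.NavierStokesRegularity.Theorems.PowerGaugeEulerLiouville

end
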